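import Mathlib
import Summits.Ventures.PercRepro2.Defs
import Summits.Ventures.PercRepro2.Harris
import Summits.Ventures.PercRepro2.TReduction
import Summits.Ventures.PercRepro2.THAntipodalCoef
import Summits.Ventures.PercRepro2.THAntipodalPair

/-!
# The signomial certificate for the three-event form: several negative base cases, each matched
to an antipodal pair of pinnings relative to its own pattern (mine-a g50)

`THAntipodalPair` repairs ONE negative base case (the main one) by one antipodal pair of
pinnings.  Here the lower bound `L` of `THAntipodalPair.kform_ge_of_base` carries an arbitrary
finite family of weighted pinned patterns (`Lsum`): it satisfies the pinning recursion with
equality (`Lsum_pin`, by `THAntipodalPair.coef_pin`), so (T_h) follows from two checkable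
conditions (`tform_nonneg_of_terms`): at every base case the weight placed on its pattern is at
most the base case (`Lsum_base` gives that weight as a finite sum of matches), and the weighted
coefficient sum is nonnegative at every admissible weight vector.  The second condition is
discharged by AM–GM for a *triple family* (`Lsum_tri_nonneg`, `tform_nonneg_of_triples`): each
negative pattern `(D_j, a_j)` with weight `w_j` is matched to the antipodal pair of pinnings of a
nonempty `S_j ⊆ D_j` (pattern `b_j` and its antipode, the edges off `D_j` kept), each with weight
`κ_j ≥ 0`, `w_j ≥ −2κ_j`: the relative antipodal product identity
`c_{D_j∖S_j, b_j} · c_{D_j∖S_j, b̄_j} = c_{D_j, a_j}²` (`coef_antipodal_mul_rel`) gives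
`κ_j (c_{b_j} + c_{b̄_j}) ≥ 2κ_j c_{D_j,a_j} ≥ −w_j c_{D_j,a_j}`.  This is the certificate of
MINE-A.md §104.3 ADDENDUM 1 (signcert.c) in the kernel, with `THAntipodalPair` the case of one
triple.  No instance, no notation.
-/

namespace Summit.Ventures.PercRepro2

namespace THSignomial

open Finset TReduction THAntipodalPair

section Terms

variable {E : Type*} [Fintype E] [DecidableEq E] {R : Type*} [Field R] [LinearOrder R]
  [IsStrictOrderedRing R]

/-- A weighted family of pinned patterns: term `i` is the pattern `(Dof i, aof i)` with weight
`w i`; `Lsum … D p = Σ_i w_i · c^{D,p}_{Dof i, aof i}`. -/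
noncomputable def Lsum {ι : Type*} [Fintype ι] (w : ι → R) (Dof : ι → Finset E)
    (aof : ι → Config E) (D : Finset E) (p : E → R) : R :=
  ∑ i, w i * coef D (Dof i) (aof i) p

omit [LinearOrder R] [IsStrictOrderedRing R] in
/-- `Lsum` satisfies the pinning recursion (with equality). -/
lemma Lsum_pin {ι : Type*} [Fintype ι] (w : ι → R) (Dof : ι → Finset E) (aof : ι → Config E)
    (D : Finset E) (p : E → R) {g : E} (hg : g ∉ D) :
    Lsum w Dof aof D p =
      (1 - p g) ^ 2 * Lsum w Dof aof D (Function.update p g 0)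
        + p g ^ 2 * Lsum w Dof aof D (Function.update p g 1)
        + p g * (1 - p g) * Lsum w Dof aof (insert g D) p := by
  unfold Lsum
  simp only [mul_sum]
  rw [← sum_add_distrib, ← sum_add_distrib]
  refine sum_congr rfl fun i _ => ?_
  rw [coef_pin D (Dof i) (aof i) p hg]
  ring

omit [IsStrictOrderedRing R] in
/-- At a base point `(D, a₀)` the weighted sum is the total weight of the terms whose pattern
matches `(D, a₀)`. -/
lemma Lsum_base {ι : Type*} [Fintype ι] (w : ι → R) (Dof : ι → Finset E) (aof : ι → Config E)
    (D : Finset E) (a₀ : E → R) (h01 : ∀ x, x ∉ D → a₀ x = 0 ∨ a₀ x = 1) :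
    Lsum w Dof aof D a₀ =
      ∑ i, if (D = Dof i ∧ ∀ x, x ∉ D → a₀ x = if aof i x then 1 else 0) then w i else 0 := by
  unfold Lsum
  refine sum_congr rfl fun i _ => ?_
  by_cases h : D = Dof i ∧ ∀ x, x ∉ D → a₀ x = if aof i x then 1 else 0
  · rw [if_pos h, h.1, coef_base_one (Dof i) (aof i) a₀ (h.1 ▸ h.2), mul_one]
  · rw [if_neg h, coef_base_zero D (Dof i) (aof i) a₀ h01 h, mul_zero]

/-- **(T_h) from a weighted family of patterns.** If at every base case the weight placed on its
pattern is at most the base case, and the weighted coefficient sum is nonnegative at every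
admissible weight vector, then (T_h) holds. -/
theorem tform_nonneg_of_terms (Q U e : Set (Config E)) {ι : Type*} [Fintype ι] (w : ι → R)
    (Dof : ι → Finset E) (aof : ι → Config E)
    (hbase : ∀ (D : Finset E) (a₀ : E → R), IsProbVec a₀ → (∀ x, x ∉ D → a₀ x = 0 ∨ a₀ x = 1) →
      Lsum w Dof aof D a₀ ≤ kform Q U e D a₀)
    (hpos : ∀ p : E → R, IsProbVec p → 0 ≤ Lsum w Dof aof ∅ p)
    (p : E → R) (hp : IsProbVec p) :
    prob p (Q ∩ U) * prob p e + prob p (Q ∩ e) * prob p U ≤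
      prob p (Q ∩ U ∩ e) + prob p Q * prob p (U ∩ e) := by
  have hge := kform_ge_of_base Q U e (Lsum w Dof aof)
    (fun D p g hg _ => le_of_eq (Lsum_pin w Dof aof D p hg)) hbase ∅ p hp
  rw [kform_empty] at hge
  unfold gform at hge
  linarith [hpos p hp]

end Terms

section Triples

variable {E : Type*} [Fintype E] [DecidableEq E] {R : Type*} [Field R] [LinearOrder R]
  [IsStrictOrderedRing R]

omit [LinearOrder R] [IsStrictOrderedRing R] in
/-- `coef ∅ D' a'` is `Π_{e ∈ D'} p_e (1 − p_e) · Π_{e ∉ D'} (edgeFactor (p e) (a' e))²`. -/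
lemma coef_empty_eq (D' : Finset E) (a' : Config E) (p : E → R) :
    coef (∅ : Finset E) D' a' p =
      (∏ e ∈ D', p e * (1 - p e)) * ∏ e ∈ univ \ D', (edgeFactor (p e) (a' e)) ^ 2 := by
  unfold coef
  rw [if_pos (empty_subset _), sdiff_empty]

/-- The pattern `a` overwritten by `b` on `S`. -/
def overwrite (S : Finset E) (a b : Config E) : Config E := fun x => if x ∈ S then b x else a x

omit [LinearOrder R] [IsStrictOrderedRing R] in
/-- **The relative antipodal product identity**: for `S ⊆ D`,
`c_{D∖S, a[b on S]} · c_{D∖S, a[b̄ on S]} = c_{D, a}²`. -/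
theorem coef_antipodal_mul_rel (D S : Finset E) (hS : S ⊆ D) (a b : Config E) (p : E → R) :
    coef (∅ : Finset E) (D \ S) (overwrite S a b) p
        * coef (∅ : Finset E) (D \ S) (overwrite S a fun x => !b x) p =
      (coef (∅ : Finset E) D a p) ^ 2 := by
  rw [coef_empty_eq, coef_empty_eq, coef_empty_eq]
  have hU : univ \ (D \ S) = (univ \ D) ∪ S := by
    ext x
    simp only [mem_sdiff, mem_univ, true_and, mem_union, not_and, not_not]
    constructor
    · intro h
      by_cases hx : x ∈ D
      · exact Or.inr (h hx)
      · exact Or.inl hx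
    · rintro (h | h)
      · exact fun hx => absurd hx h
      · exact fun _ => h
  have hdisj : Disjoint (univ \ D) S := disjoint_of_subset_right hS sdiff_disjoint
  have h1 : ∀ c : Config E, ∏ e ∈ univ \ (D \ S), (edgeFactor (p e) (overwrite S a c e)) ^ 2 =
      (∏ e ∈ univ \ D, (edgeFactor (p e) (a e)) ^ 2) * ∏ e ∈ S, (edgeFactor (p e) (c e)) ^ 2 := by
    intro c
    rw [hU, prod_union hdisj]
    congr 1
    · refine prod_congr rfl fun x hx => ?_
      have hxS : x ∉ S := fun h => (mem_sdiff.1 hx).2 (hS h)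
      simp [overwrite, hxS]
    · refine prod_congr rfl fun x hx => ?_
      simp [overwrite, hx]
  rw [h1, h1]
  have h2 : (∏ e ∈ S, (edgeFactor (p e) (b e)) ^ 2) * ∏ e ∈ S, (edgeFactor (p e) (!b e)) ^ 2 =
      (∏ e ∈ S, p e * (1 - p e)) ^ 2 := by
    rw [← prod_mul_distrib, ← prod_pow]
    refine prod_congr rfl fun x _ => ?_
    rw [← mul_pow, edgeFactor_mul_edgeFactor_not]
  have h3 : (∏ e ∈ D \ S, p e * (1 - p e)) * ∏ e ∈ S, p e * (1 - p e) =
      ∏ e ∈ D, p e * (1 - p e) := prod_sdiff hS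
  calc (∏ e ∈ D \ S, p e * (1 - p e)) *
          ((∏ e ∈ univ \ D, (edgeFactor (p e) (a e)) ^ 2) * ∏ e ∈ S, (edgeFactor (p e) (b e)) ^ 2) *
        ((∏ e ∈ D \ S, p e * (1 - p e)) *
          ((∏ e ∈ univ \ D, (edgeFactor (p e) (a e)) ^ 2) *
            ∏ e ∈ S, (edgeFactor (p e) (!b e)) ^ 2))
      = (∏ e ∈ D \ S, p e * (1 - p e)) ^ 2 * (∏ e ∈ univ \ D, (edgeFactor (p e) (a e)) ^ 2) ^ 2 *
          ((∏ e ∈ S, (edgeFactor (p e) (b e)) ^ 2) * ∏ e ∈ S, (edgeFactor (p e) (!b e)) ^ 2) := by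
        ring
    _ = (∏ e ∈ D \ S, p e * (1 - p e)) ^ 2 * (∏ e ∈ univ \ D, (edgeFactor (p e) (a e)) ^ 2) ^ 2 *
          (∏ e ∈ S, p e * (1 - p e)) ^ 2 := by rw [h2]
    _ = ((∏ e ∈ D \ S, p e * (1 - p e)) * ∏ e ∈ S, p e * (1 - p e)) ^ 2 *
          (∏ e ∈ univ \ D, (edgeFactor (p e) (a e)) ^ 2) ^ 2 := by ring
    _ = _ := by rw [h3]; ring

/-- **The triple family**: for each `j`, the negative pattern `(Dof j, aof j)` with weight `w j`
and the antipodal pair of pinnings of `Sof j` (pattern `bof j` and its antipode), each with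
weight `κ j` — indexed by `J ⊕ (J ⊕ J)`. -/
noncomputable def triW {J : Type*} (w κ : J → R) : J ⊕ (J ⊕ J) → R :=
  Sum.elim w (Sum.elim κ κ)

/-- The patterns' edge sets of the triple family. -/
def triD {J : Type*} (Dof Sof : J → Finset E) : J ⊕ (J ⊕ J) → Finset E :=
  Sum.elim Dof (Sum.elim (fun j => Dof j \ Sof j) fun j => Dof j \ Sof j)

/-- The patterns' states of the triple family. -/
def triA {J : Type*} (Sof : J → Finset E) (aof bof : J → Config E) : J ⊕ (J ⊕ J) → Config E :=
  Sum.elim aof (Sum.elim (fun j => overwrite (Sof j) (aof j) (bof j))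
    fun j => overwrite (Sof j) (aof j) fun x => !bof j x)

/-- **The weighted coefficient sum of a triple family is nonnegative** at every admissible
weight vector, when `κ_j ≥ 0` and `w_j ≥ −2κ_j` (AM–GM on each antipodal pair). -/
theorem Lsum_tri_nonneg {J : Type*} [Fintype J] (w κ : J → R) (Dof Sof : J → Finset E)
    (aof bof : J → Config E) (hS : ∀ j, Sof j ⊆ Dof j) (hκ : ∀ j, 0 ≤ κ j)
    (hw : ∀ j, -(2 * κ j) ≤ w j) (p : E → R) (hp : IsProbVec p) :
    0 ≤ Lsum (triW w κ) (triD Dof Sof) (triA Sof aof bof) ∅ p := by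
  unfold Lsum
  rw [Fintype.sum_sum_type, Fintype.sum_sum_type, ← sum_add_distrib, ← sum_add_distrib]
  refine sum_nonneg fun j _ => ?_
  simp only [triW, triD, triA, Sum.elim_inl, Sum.elim_inr]
  have h0 : 0 ≤ coef (∅ : Finset E) (Dof j) (aof j) p := coef_nonneg _ _ _ hp
  have h1 : 0 ≤ coef (∅ : Finset E) (Dof j \ Sof j) (overwrite (Sof j) (aof j) (bof j)) p :=
    coef_nonneg _ _ _ hp
  have h2 : 0 ≤ coef (∅ : Finset E) (Dof j \ Sof j) (overwrite (Sof j) (aof j) fun x => !bof j x) p :=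
    coef_nonneg _ _ _ hp
  have hprod := coef_antipodal_mul_rel (Dof j) (Sof j) (hS j) (aof j) (bof j) p
  have hamgm := two_mul_le_add_of_mul_eq_sq h1 h2 hprod
  have e1 := mul_le_mul_of_nonneg_left hamgm (hκ j)
  have e2 := mul_le_mul_of_nonneg_right (hw j) h0
  nlinarith

/-- **(T_h) from a signomial certificate**: a triple family whose weight at every base case is at
most the base case (`hbase`, through `Lsum_base`) with `κ_j ≥ 0`, `w_j ≥ −2κ_j`, `∅ ≠ S_j ⊆ D_j`
proves (T_h) for every admissible weight vector. -/
theorem tform_nonneg_of_triples (Q U e : Set (Config E)) {J : Type*} [Fintype J] (w κ : J → R)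
    (Dof Sof : J → Finset E) (aof bof : J → Config E) (hS : ∀ j, Sof j ⊆ Dof j)
    (hκ : ∀ j, 0 ≤ κ j) (hw : ∀ j, -(2 * κ j) ≤ w j)
    (hbase : ∀ (D : Finset E) (a₀ : E → R), IsProbVec a₀ → (∀ x, x ∉ D → a₀ x = 0 ∨ a₀ x = 1) →
      Lsum (triW w κ) (triD Dof Sof) (triA Sof aof bof) D a₀ ≤ kform Q U e D a₀)
    (p : E → R) (hp : IsProbVec p) :
    prob p (Q ∩ U) * prob p e + prob p (Q ∩ e) * prob p U ≤
      prob p (Q ∩ U ∩ e) + prob p Q * prob p (U ∩ e) :=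
  tform_nonneg_of_terms Q U e (triW w κ) (triD Dof Sof) (triA Sof aof bof) hbase
    (fun p hp => Lsum_tri_nonneg w κ Dof Sof aof bof hS hκ hw p hp) p hp

end Triples

end THSignomial

end Summit.Ventures.PercRepro2
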